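import Mathlib
import Summits.Ventures.PercRepro2.Harris
import Summits.Ventures.PercRepro2.BasePrime
import Summits.Ventures.PercRepro2.LocRows
import Summits.Ventures.PercRepro2.SwRow
import Summits.Ventures.PercRepro2.SwOutCube
import Summits.Ventures.PercRepro2.SwOutMixedCubeFarDefs

/-!
# The twisted cube lemma WITH far arms (blind cell PercRepro2, night-4 g16, 2026-08-26;
proofs/NIGHT4-G12.md §5′(b)–(d), proofs/NIGHT4-G16.md §6)

The abstract combinatorial core of the one-mixed-arm block of NIGHT4-G12.md §5′, with the far
arms as further cube coordinates (G12 had this only as random tests; vocabulary in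
`SwOutMixedCubeFarDefs`).  **`mixedCubeFar_card_le`**: for every lower set `Q` of the block
`Bool × Config (Fin 2 ⊕ κ)` (the seal bit, the atoms `X`, `A` and the far arms) and every up-set
`𝓔` of atom sets, the block minus the one-sided point and its mirror (with every far colouring)
satisfies the rigid counting inequality.  Proof by the two layers: the layer `ε = false` is a full
cube — the cube principle `card_inter_le_of_cube` (`card_bottom_le`); in the layer `ε = true` the
remaining points are the corners `X = A = false` and `X = A = true` over their far fibres
`L₀ ⊇ L₁` (lower sets of the far cube) with up-sets `U₀ ⊆ U₁`, and the blue count pairs a corner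
with the antipodal fibre of the OTHER corner — two cube principles on the far cube and the
exchange `|(L₀ ∖ L₁) ∩ σU₀| ≤ |(L₀ ∖ L₁) ∩ σU₁|` (σ = the antipode) finish it (`card_top_le`).
-/

namespace Summit.Ventures.PercRepro2

namespace MixedCube

open scoped Classical

variable {κ : Type*} [Fintype κ] [DecidableEq κ]

section Main

variable (Q : Set (PtF κ)) (𝓔 : Set (Set (Atom κ)))

/-- The far fibre of the corner `X = A = c` of the top layer. -/
def fibreL (c : Bool) : Set (Config κ) := {f | (true, setXA c f) ∈ Q}

/-- The far colourings at which the corner `X = A = c` is red-accepted. -/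
def fibreU (c : Bool) : Set (Config κ) := {f | redAtoms (setXA c f) ∈ 𝓔}

variable {Q 𝓔} (hQ : IsLowerSet Q) (h𝓔 : IsUpperSet 𝓔)
include hQ h𝓔

omit h𝓔 [Fintype κ] [DecidableEq κ] in
/-- The fibres are lower sets. -/
lemma fibreL_isLowerSet (c : Bool) : IsLowerSet (fibreL Q c) := by
  intro f f' hle hf
  exact hQ (Prod.mk_le_mk.2 ⟨le_refl _, setXA_mono c hle⟩) hf

omit hQ [Fintype κ] [DecidableEq κ] in
/-- The accepted sets are up-sets. -/
lemma fibreU_isUpperSet (c : Bool) : IsUpperSet (fibreU 𝓔 c) := by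
  intro f f' hle hf
  exact h𝓔 (redAtoms_mono (setXA_mono c hle)) hf

omit h𝓔 [Fintype κ] [DecidableEq κ] in
/-- The fibre of the upper corner lies in the fibre of the lower corner. -/
lemma fibreL_true_subset : fibreL Q true ⊆ fibreL Q false := by
  intro f hf
  exact hQ (Prod.mk_le_mk.2 ⟨le_refl _, setXA_false_le_true f⟩) hf

omit hQ [Fintype κ] [DecidableEq κ] in
/-- The accepted set of the lower corner lies in that of the upper corner. -/
lemma fibreU_false_subset : fibreU 𝓔 false ⊆ fibreU 𝓔 true := by
  intro f hf
  exact h𝓔 (redAtoms_mono (setXA_false_le_true f)) hf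

omit hQ [Fintype κ] [DecidableEq κ] in
/-- The antipode of an accepted set is a lower set. -/
lemma flipAll_preimage_fibreU_isLowerSet (c : Bool) :
    IsLowerSet (flipAll ⁻¹' fibreU 𝓔 c) := by
  intro f f' hle hf
  exact fibreU_isUpperSet h𝓔 c (flipAll_le_flipAll' hle) hf

omit hQ h𝓔 [Fintype κ] [DecidableEq κ] in
/-- The antipode is an involution on sets. -/
lemma flipAll_preimage_preimage (U : Set (Config κ)) : flipAll ⁻¹' (flipAll ⁻¹' U) = U := by
  ext f
  simp only [Set.mem_preimage, flipAll_involutive f]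

/-- **The cube principle on a far fibre.** -/
lemma card_fibre_le (c : Bool) :
    (Finset.univ.filter (· ∈ fibreL Q c ∩ fibreU 𝓔 c)).card ≤
      (Finset.univ.filter (· ∈ fibreL Q c ∩ flipAll ⁻¹' fibreU 𝓔 c)).card :=
  LocRows.card_inter_le_of_cube (fibreL_isLowerSet hQ c) (fibreU_isUpperSet h𝓔 c)
    (flipAll_preimage_fibreU_isLowerSet h𝓔 c) (flipAll_preimage_preimage _)

/-- **The top layer minus the middle satisfies the rigid inequality.** -/
theorem card_top_le :
    (Finset.univ.filter fun ω : Config (Atom κ) =>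
        ω (Sum.inl 0) = ω (Sum.inl 1) ∧ ((true, ω) ∈ Q ∧ redAtoms ω ∈ 𝓔)).card ≤
      (Finset.univ.filter fun ω : Config (Atom κ) =>
        ω (Sum.inl 0) = ω (Sum.inl 1) ∧ ((true, ω) ∈ Q ∧ redAtoms (flipAll ω) ∈ 𝓔)).card := by
  rw [card_filter_top (S := fun ω => (true, ω) ∈ Q ∧ redAtoms ω ∈ 𝓔),
    card_filter_top (S := fun ω => (true, ω) ∈ Q ∧ redAtoms (flipAll ω) ∈ 𝓔),
    card_filter_fibre false (S := fun ω => (true, ω) ∈ Q ∧ redAtoms ω ∈ 𝓔),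
    card_filter_fibre true (S := fun ω => (true, ω) ∈ Q ∧ redAtoms ω ∈ 𝓔),
    card_filter_fibre false (S := fun ω => (true, ω) ∈ Q ∧ redAtoms (flipAll ω) ∈ 𝓔),
    card_filter_fibre true (S := fun ω => (true, ω) ∈ Q ∧ redAtoms (flipAll ω) ∈ 𝓔)]
  -- the four counts as fibre counts
  have e1 : (Finset.univ.filter fun f : Config κ =>
      (true, setXA false f) ∈ Q ∧ redAtoms (setXA false f) ∈ 𝓔) =
      Finset.univ.filter (· ∈ fibreL Q false ∩ fibreU 𝓔 false) := by
    apply Finset.filter_congr; intro f _; rfl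
  have e2 : (Finset.univ.filter fun f : Config κ =>
      (true, setXA true f) ∈ Q ∧ redAtoms (setXA true f) ∈ 𝓔) =
      Finset.univ.filter (· ∈ fibreL Q true ∩ fibreU 𝓔 true) := by
    apply Finset.filter_congr; intro f _; rfl
  have e3 : (Finset.univ.filter fun f : Config κ =>
      (true, setXA false f) ∈ Q ∧ redAtoms (flipAll (setXA false f)) ∈ 𝓔) =
      Finset.univ.filter (· ∈ fibreL Q false ∩ flipAll ⁻¹' fibreU 𝓔 true) := by
    apply Finset.filter_congr; intro f _
    simp only [flipAll_setXA, Bool.not_false, fibreL, fibreU, Set.mem_inter_iff,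
      Set.mem_preimage, Set.mem_setOf_eq]
  have e4 : (Finset.univ.filter fun f : Config κ =>
      (true, setXA true f) ∈ Q ∧ redAtoms (flipAll (setXA true f)) ∈ 𝓔) =
      Finset.univ.filter (· ∈ fibreL Q true ∩ flipAll ⁻¹' fibreU 𝓔 false) := by
    apply Finset.filter_congr; intro f _
    simp only [flipAll_setXA, Bool.not_true, fibreL, fibreU, Set.mem_inter_iff,
      Set.mem_preimage, Set.mem_setOf_eq]
  rw [e1, e2, e3, e4]
  have c0 := card_fibre_le hQ h𝓔 false
  have c1 := card_fibre_le hQ h𝓔 true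
  have ex := card_exchange (fibreL_true_subset hQ)
    (Set.preimage_mono (fibreU_false_subset h𝓔) : flipAll ⁻¹' fibreU 𝓔 false ⊆
      flipAll ⁻¹' fibreU 𝓔 true)
  omega

/-- **The bottom layer satisfies the rigid inequality** (the cube principle). -/
theorem card_bottom_le :
    (Finset.univ.filter fun ω : Config (Atom κ) => (false, ω) ∈ Q ∧ redAtoms ω ∈ 𝓔).card ≤
      (Finset.univ.filter fun ω : Config (Atom κ) =>
        (false, ω) ∈ Q ∧ redAtoms (flipAll ω) ∈ 𝓔).card := by
  have hL : IsLowerSet {ω : Config (Atom κ) | (false, ω) ∈ Q} := by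
    intro ω ω' hle hω
    exact hQ (Prod.mk_le_mk.2 ⟨le_refl _, hle⟩) hω
  have hA : IsUpperSet {ω : Config (Atom κ) | redAtoms ω ∈ 𝓔} := by
    intro ω ω' hle hω
    exact h𝓔 (redAtoms_mono hle) hω
  have hB : IsLowerSet {ω : Config (Atom κ) | redAtoms (flipAll ω) ∈ 𝓔} := by
    intro ω ω' hle hω
    exact h𝓔 (redAtoms_mono (flipAll_le_flipAll' hle)) hω
  have hAB : flipAll ⁻¹' {ω : Config (Atom κ) | redAtoms (flipAll ω) ∈ 𝓔} =
      {ω : Config (Atom κ) | redAtoms ω ∈ 𝓔} := by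
    ext ω
    simp only [Set.mem_preimage, Set.mem_setOf_eq, flipAll_involutive ω]
  have key := LocRows.card_inter_le_of_cube hL hA hB hAB
  convert key using 2
  · apply Finset.filter_congr
    intro ω _
    simp only [Set.mem_inter_iff, Set.mem_setOf_eq]
  · apply Finset.filter_congr
    intro ω _
    simp only [Set.mem_inter_iff, Set.mem_setOf_eq]

/-- **THE TWISTED CUBE LEMMA WITH FAR ARMS**: for every lower set `Q` of the block and every
up-set `𝓔` of atom sets, the block minus the removed points (the one-sided point and its mirror
with every far colouring) satisfies the rigid counting inequality. -/
theorem mixedCubeFar_card_le :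
    (Finset.univ.filter (redOK Q 𝓔)).card ≤ (Finset.univ.filter (blueOK Q 𝓔)).card := by
  rw [card_filter_prod_bool (redOK Q 𝓔), card_filter_prod_bool (blueOK Q 𝓔)]
  have hb : ∀ ω : Config (Atom κ), ¬ MidTop (false, ω) := by
    intro ω h
    exact Bool.false_ne_true h.1
  have ht : ∀ ω : Config (Atom κ), ¬ MidTop (true, ω) ↔ ω (Sum.inl 0) = ω (Sum.inl 1) := by
    intro ω
    simp only [MidTop, true_and, not_not]
  have f1 : (Finset.univ.filter fun ω : Config (Atom κ) => redOK Q 𝓔 (false, ω)) =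
      Finset.univ.filter fun ω : Config (Atom κ) => (false, ω) ∈ Q ∧ redAtoms ω ∈ 𝓔 := by
    apply Finset.filter_congr; intro ω _
    simp only [redOK, hb ω, not_false_eq_true, true_and]
  have f2 : (Finset.univ.filter fun ω : Config (Atom κ) => blueOK Q 𝓔 (false, ω)) =
      Finset.univ.filter fun ω : Config (Atom κ) =>
        (false, ω) ∈ Q ∧ redAtoms (flipAll ω) ∈ 𝓔 := by
    apply Finset.filter_congr; intro ω _
    simp only [blueOK, hb ω, not_false_eq_true, true_and]
  have f3 : (Finset.univ.filter fun ω : Config (Atom κ) => redOK Q 𝓔 (true, ω)) =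
      Finset.univ.filter fun ω : Config (Atom κ) =>
        ω (Sum.inl 0) = ω (Sum.inl 1) ∧ ((true, ω) ∈ Q ∧ redAtoms ω ∈ 𝓔) := by
    apply Finset.filter_congr; intro ω _
    simp only [redOK, ht ω]
    constructor
    · rintro ⟨hQ', h01, hE⟩; exact ⟨h01, hQ', hE⟩
    · rintro ⟨h01, hQ', hE⟩; exact ⟨hQ', h01, hE⟩
  have f4 : (Finset.univ.filter fun ω : Config (Atom κ) => blueOK Q 𝓔 (true, ω)) =
      Finset.univ.filter fun ω : Config (Atom κ) =>
        ω (Sum.inl 0) = ω (Sum.inl 1) ∧ ((true, ω) ∈ Q ∧ redAtoms (flipAll ω) ∈ 𝓔) := by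
    apply Finset.filter_congr; intro ω _
    simp only [blueOK, ht ω]
    constructor
    · rintro ⟨hQ', h01, hE⟩; exact ⟨h01, hQ', hE⟩
    · rintro ⟨h01, hQ', hE⟩; exact ⟨hQ', h01, hE⟩
  rw [f1, f2, f3, f4]
  have hbot := card_bottom_le hQ h𝓔
  have htop := card_top_le hQ h𝓔
  omega

end Main

end MixedCube

end Summit.Ventures.PercRepro2
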